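import Mathlib
import Summits.Ventures.PercRepro2.A3BStarModel
import Summits.Ventures.PercRepro2.A3BStarCert0

/-!
# The certificate of the star `N(o) ⊆ {a₃, b}`, assembled (blind cell PercRepro2, mine-2 g39,
2026-08-28; `proofs/MINE2-GLUE.md` §7, row M2-83)

From the kernel-decided `cert3b` (the middle slot `o–a₁` absent, every type of `o–a₃`, `o–b`, every
SORTED triple of `Q`-patterns): `C3_nonneg_sorted`, `C3_nonneg_validQ` (every ordered triple, by
the symmetry of the gadget sum and a sort) and **`C3_nonneg`** — `0 ≤ C3 t₁ 0 t_b` on every triple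
of set partitions of the four marks, a pattern joining the roots contributing `0`.  Own code;
standard axioms.
-/

namespace Summit.Ventures.PercRepro2

namespace CovForm

namespace OStar

/-- The sorted certificate for every typing with types `≤ 3` and the middle slot absent. -/
theorem C3_nonneg_sorted {t₁ tb : ℕ} (h₁ : t₁ ≤ 3) (hb : tb ≤ 3)
    {P₁ P₂ P₃ : Pat} (v₁ : validQ3 P₁ = true) (v₂ : validQ3 P₂ = true) (v₃ : validQ3 P₃ = true)
    (k₁₂ : key P₁ ≤ key P₂) (k₂₃ : key P₂ ≤ key P₃) : 0 ≤ C3 t₁ 0 tb P₁ P₂ P₃ := by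
  obtain ⟨b₁, b₂, b₃, b₄, b₅, b₆⟩ := P₁
  obtain ⟨c₁, c₂, c₃, c₄, c₅, c₆⟩ := P₂
  obtain ⟨d₁, d₂, d₃, d₄, d₅, d₆⟩ := P₃
  exact cert3b ⟨t₁, by omega⟩ ⟨tb, by omega⟩ b₁ b₂ b₃ b₄ b₅ b₆ v₁ c₁ c₂ c₃ c₄ c₅ c₆ v₂ k₁₂
    d₁ d₂ d₃ d₄ d₅ d₆ v₃ k₂₃

/-- The certificate on every ordered triple of `Q`-patterns. -/
theorem C3_nonneg_validQ {t₁ tb : ℕ} (h₁ : t₁ ≤ 3) (hb : tb ≤ 3)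
    {P₁ P₂ P₃ : Pat} (v₁ : validQ3 P₁ = true) (v₂ : validQ3 P₂ = true) (v₃ : validQ3 P₃ = true) :
    0 ≤ C3 t₁ 0 tb P₁ P₂ P₃ := by
  obtain ⟨e12, e23, e231, e312, e321⟩ := C3_perm t₁ 0 tb P₁ P₂ P₃
  rcases le_total (key P₁) (key P₂) with h12 | h21 <;>
    rcases le_total (key P₂) (key P₃) with h23 | h32 <;>
    rcases le_total (key P₁) (key P₃) with h13 | h31
  · exact C3_nonneg_sorted h₁ hb v₁ v₂ v₃ h12 h23
  · exact C3_nonneg_sorted h₁ hb v₁ v₂ v₃ h12 h23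
  · rw [e23]; exact C3_nonneg_sorted h₁ hb v₁ v₃ v₂ h13 h32
  · rw [e312]; exact C3_nonneg_sorted h₁ hb v₃ v₁ v₂ h31 h12
  · rw [e12]; exact C3_nonneg_sorted h₁ hb v₂ v₁ v₃ h21 h13
  · rw [e231]; exact C3_nonneg_sorted h₁ hb v₂ v₃ v₁ h23 h31
  · rw [e321]; exact C3_nonneg_sorted h₁ hb v₃ v₂ v₁ h32 h21
  · rw [e321]; exact C3_nonneg_sorted h₁ hb v₃ v₂ v₁ h32 h21

/-- **The certificate of `N(o) ⊆ {a₃, b}`**: the gadget sum with the middle slot absent is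
nonnegative on every typing with types `≤ 3` and every triple of set partitions. -/
theorem C3_nonneg {t₁ tb : ℕ} (h₁ : t₁ ≤ 3) (hb : tb ≤ 3)
    {P₁ P₂ P₃ : Pat} (v₁ : valid P₁ = true) (v₂ : valid P₂ = true) (v₃ : valid P₃ = true) :
    0 ≤ C3 t₁ 0 tb P₁ P₂ P₃ := by
  by_cases q₁ : P₁.2.2.2.1 = true
  · rw [C3_eq_zero_of_p12 t₁ 0 tb (Or.inl q₁)]
  by_cases q₂ : P₂.2.2.2.1 = true
  · rw [C3_eq_zero_of_p12 t₁ 0 tb (Or.inr (Or.inl q₂))]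
  by_cases q₃ : P₃.2.2.2.1 = true
  · rw [C3_eq_zero_of_p12 t₁ 0 tb (Or.inr (Or.inr q₃))]
  refine C3_nonneg_validQ h₁ hb ?_ ?_ ?_
  · simp [validQ3, v₁, q₁]
  · simp [validQ3, v₂, q₂]
  · simp [validQ3, v₃, q₃]

end OStar

end CovForm

end Summit.Ventures.PercRepro2
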